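import Mathlib.Analysis.SpecialFunctions.Pow.Asymptotics
import Mathlib.Analysis.SpecialFunctions.Pow.Real
import Literature.Computability.Complexity.MurrayWilliams2018
import Literature.Computability.Complexity.GrowthBounds
import Literature.Computability.Complexity.SymPlus
import Literature.Computability.MetaComplexity.TruthTables
import HarnessLib

/-!
# Williams' `ACC`-SAT algorithm (J. ACM 2014, Thm. 4.1): the printed proof, second layer

`Williams2014.lean` vendors the `ACC`-satisfiability algorithm behind `NEXP ⊄ ACC⁰` in the
polynomial-size form in which the proof of Thm. 1.1 uses it (p. 18: "the Circuit SAT algorithm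
of Theorem 4.1 can determine satisfiability of any `n + c log n` input, `n ^ c` size ACC circuit
in `O(2^{n - log² n})` time, for every constant `c`") as the named fact
`Williams2014_accSat_polysize`. This file DECOMPOSES that fact along the printed proof
(Williams 2014, §4) and PROVES the first reduction:

* `Williams2014_thm_4_1` — **Theorem 4.1 as printed** (named fact): for every depth `d > 1`
  (and modulus `m ≥ 2`) there are `0 < ε < 1`, `δ > ε` and `a > 0` such that satisfiability of
  depth-`d` `AC⁰[m]` circuits with `n` inputs and size (eventually) at most `2^{n^ε}` is
  decidable in time `O(2^{n - a n^δ})`, in the format `AccSatInTime` of `Williams2014.lean`;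
* `Williams2014_accSat_polysize_of_thm_4_1` — **proved**: Thm. 4.1 implies
  `Williams2014_accSat_polysize` (the p. 18 remark): `n ^ c + c ≤ 2^{n^ε}` and
  `2^{n - a n^δ} ≤ 2ⁿ / 2^{(log₂ n)²}` for `n` large (`log x = o(x^ε)`, Mathlib's
  `isLittleO_log_rpow_atTop`), the finitely many small `n` being absorbed by the additive
  constant of the time bound (`AccSatInTime.of_le_of_bdd`), and depth `d ≤ 1` being a sub-case
  of depth `2` (`AccSatInTime.anti_depth`); likewise **proved**:
  `MurrayWilliams2018_thm_5_1_of_thm_4_1` — Thm. 4.1 implies its `ε = 1/r` rendering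
  `MurrayWilliams2018_thm_5_1` (`MurrayWilliams2018.lean`, size `2^{⌊n^{1/r}⌋}`, time
  `O(2^{n - ⌊n^{1/r}⌋})`, any integer `r > 1/ε`), so that both consumers of Williams' algorithm in
  the tree rest on the one fact stated as printed;
* the two components of the printed proof of Thm. 4.1 as named facts over Mathlib's `TM2`:
  `Williams2014_lemma_4_1` — the **algorithmic** Yao–Beigel–Tarui–Allender–Gore conversion
  (Lemma 4.1 with Appendix A: an `ACC` circuit of depth `d` and size `s` is converted into an
  equivalent `SYM⁺` circuit of size `s^{O(log^{f(d)} s)}` in that much time, the symmetric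
  function being evaluable in the same time), whose existence half is the tree's THEOREM
  `Williams2014_symPlus_of_acc_holds` (`SymPlusProofs.lean`); and `Williams2014_lemma_4_2` — the
  **evaluation lemma** (Lemma 4.2: the truth table of a `SYM⁺` circuit with `n` inputs and
  `s ≤ 2^{0.1 n}` terms is computable in `(2ⁿ + poly(s)) · poly(n)` time; Proof 2 there, Yates'
  zeta transform, whose mathematics is proved in `YatesZeta.lean`);
* the string encoding `encodeSymPlus` of a `SYM⁺` circuit (terms as sorted index lists, the
  symmetric gate as its value table on `0, …, #terms`), needed to state the two lemmas.

## Faithfulness notes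

* Thm. 4.1 is printed for "ACC circuits" with `MOD_m` gates for a fixed constant `m` and with
  `ε, δ` depending on `d`; the exponent of Lemma 4.1 depends on `m` as well (Beigel–Tarui), so
  `ε, δ, a` are quantified after `d` and `m`, which is the form the proof yields and the form
  `AccSatInTime`/`Williams2014_accSat_polysize` consume. The hypothesis `d > 1` is kept.
* "size `2^{n^ε}` … time `2^{n - Ω(n^δ)}`" is an asymptotic statement about one algorithm that
  is correct on every circuit; we render it as: for every size bound `s : ℕ → ℕ` that is
  eventually `≤ 2^{n^ε}`, `AccSatInTime d m s ⌊2^{n - a n^δ}⌋₊` (time `c · T n + c`; below the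
  threshold there are finitely many instances of size `≤ s n`, answered by the same algorithm
  within the additive constant). Instantiating `s n = ⌊2^{n^ε}⌋₊` recovers the literal reading.
* Lemma 4.1 is printed with one algorithm for all depths ("and function `f : ℕ → ℕ`"); we state
  it per `(d, m)` with one exponent `e` absorbing `O(log^{f(d)} s) · log s ≤ (log₂ s + 2)^e`
  (weaker, and what Thm. 4.1 uses), sizes in gates with fan-in `≤ s` and `n ≤ s` exactly as in
  `Williams2014_symPlus_of_acc`. Its "furthermore" clause (the symmetric function is evaluable
  in `s^{O(log^{f(d)} s)}` time given the count) is rendered by making the machine output the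
  value table of the symmetric gate on `0, …, #terms` as part of `encodeSymPlus` within the same
  time bound (at most `2^{(log₂ s+2)^e} + 1` values).
* Lemma 4.2 is printed for a symmetric function "that can be evaluated in `poly(s)` time"; with
  the table in the input this is a lookup. The hypothesis `s ≤ 2^{0.1 n}` (needed by Proof 1,
  rectangular matrix multiplication) is kept as `s ^ 10 ≤ 2 ^ n`. The truth table is the tree's
  `MetaComplexity.truthTable` (point `i < 2ⁿ` = binary digits, least significant first), one of
  the "`i`-th variable assignment" orders the lemma allows.
* Machines are Mathlib's multi-stack `TM2` (`TM2ComputableAux Bool Bool`, `OutputsWithin`), as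
  everywhere in the tree; Williams, App. C implements Lemma 4.2 on multitape machines, which two
  stacks per tape simulate step for step.

## What is NOT here (recorded for the further decomposition, see the unit's NOTES)

The assembly of `Williams2014_thm_4_1` from the two lemmas is a machine construction (parse the
circuit, build the OR of the `2^ℓ` restrictions of the first `ℓ = n^{1/(2e)}` inputs, run the
conversion, run the evaluation, scan the table) and is left to the discharge of the fact, as are
the two lemmas themselves (the conversion needs the small-seed isolation of App. A,
Transformations 1–2, not the union-bound derandomisation of `SymPlusProofs.lean`).

## References

* R. Williams, *Nonuniform ACC circuit lower bounds*, J. ACM 61(1) (2014) 2:1–2:32, §4: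
  Lemma 4.1 (with Appendix A), Lemma 4.2 (with Proof 2 and Appendix C), Thm. 4.1 and its proof,
  proof of Thm. 1.1 (p. 18) [Williams2014].
* R. Beigel, J. Tarui, *On ACC*, Comput. Complexity 4 (1994) 350–366, Thm. 1.1 [BeigelTarui1994].
-/

namespace Literature.Computability.Complexity

open _root_.Computability Turing Filter Asymptotics Finset

/-! ### Theorem 4.1 as printed -/

/-- **Williams' `ACC`-SAT algorithm** (Williams 2014, Thm. 4.1: "For every `d > 1` there is an
`ε ∈ (0,1)` such that satisfiability of depth-`d` ACC circuits with `n` inputs and `2^{n^ε}`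
size can be determined in `2^{n−Ω(n^δ)}` time for some `δ > ε` that depends only on `d`").
Statement, per depth `d > 1` and modulus `m ≥ 2` (the modulus is a fixed constant in the source;
the exponents may depend on it): there are reals `0 < ε < 1`, `δ > ε`, `a > 0` such that for
every size bound `s : ℕ → ℕ` with `s n ≤ 2^{n^ε}` for all large `n`, satisfiability of
`accBasis m`-circuits of `acDepth ≤ d` with `n` inputs, at most `s n` gates and fan-in `≤ s n`
is decidable by one TM2 machine in time `c · ⌊2^{n - a·n^δ}⌋ + c` (`AccSatInTime`,
`Williams2014.lean`; see the module docstring for why the "eventually" form is the printed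
asymptotic claim). Proved in the source from Lemma 4.1 (conversion to `SYM⁺`,
`Williams2014_lemma_4_1`) and Lemma 4.2 (evaluation, `Williams2014_lemma_4_2`) applied to the
OR of the `2^ℓ` restrictions of the first `ℓ = n^{1/(2e)}` inputs. [cite: Williams2014, Thm. 4.1] -/
def Williams2014_thm_4_1 : Prop :=
  ∀ d m : ℕ, 1 < d → 2 ≤ m → ∃ ε δ a : ℝ, 0 < ε ∧ ε < 1 ∧ ε < δ ∧ 0 < a ∧
    ∀ (s : ℕ → ℕ) (N : ℕ), (∀ n, N ≤ n → (s n : ℝ) ≤ 2 ^ ((n : ℝ) ^ ε)) →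
      AccSatInTime d m s (fun n => ⌊(2 : ℝ) ^ ((n : ℝ) - a * (n : ℝ) ^ δ)⌋₊)

/-! ### The p. 18 remark: Theorem 4.1 at polynomial size -/

/-- Polynomials are eventually below `2^{n^ε}`: for every `c` and `ε > 0` there is `N` with
`n ^ c + c ≤ 2^{n^ε}` for `n ≥ N` (from `log x = o(x^ε)`). [folklore] -/
theorem exists_pow_add_le_two_rpow (c : ℕ) {ε : ℝ} (hε : 0 < ε) :
    ∃ N : ℕ, ∀ n, N ≤ n → ((n ^ c + c : ℕ) : ℝ) ≤ 2 ^ ((n : ℝ) ^ ε) := by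
  have hκ : 0 < Real.log 2 / (c + 1) := div_pos (Real.log_pos one_lt_two) (by positivity)
  obtain ⟨X, hX⟩ := Filter.eventually_atTop.1 ((isLittleO_log_rpow_atTop hε).def hκ)
  refine ⟨max ⌈X⌉₊ (max 2 c), fun n hn => ?_⟩
  have hnX : X ≤ n := (Nat.le_ceil X).trans (by exact_mod_cast (le_max_left _ _).trans hn)
  have hn2 : 2 ≤ n := (le_max_left 2 c).trans ((le_max_right _ _).trans hn)
  have hnc : c ≤ n := (le_max_right 2 c).trans ((le_max_right _ _).trans hn)
  have hn0 : (0 : ℝ) < n := by exact_mod_cast (zero_lt_two.trans_le hn2)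
  -- `n ^ c + c ≤ n ^ (c + 1)` as naturals
  have hnat : n ^ c + c ≤ n ^ (c + 1) := by
    have h1 : c ≤ n ^ c := by
      rcases Nat.eq_zero_or_pos c with rfl | hc
      · exact Nat.zero_le _
      · exact hnc.trans (Nat.le_self_pow hc.ne' n)
    calc n ^ c + c ≤ n ^ c + n ^ c := Nat.add_le_add_left h1 _
      _ = 2 * n ^ c := by ring
      _ ≤ n * n ^ c := Nat.mul_le_mul_right _ hn2
      _ = n ^ (c + 1) := by ring
  -- `log n ≤ κ n^ε`, hence `(c+1) log n ≤ log 2 · n^ε`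
  have hlog := hX n hnX
  rw [Real.norm_eq_abs, Real.norm_eq_abs, abs_of_nonneg (Real.log_nonneg (by exact_mod_cast
    (le_trans (by norm_num) hn2))), abs_of_nonneg (Real.rpow_nonneg hn0.le ε)] at hlog
  have hlog' : ((c : ℝ) + 1) * Real.log n ≤ Real.log 2 * (n : ℝ) ^ ε := by
    have := mul_le_mul_of_nonneg_left hlog (show (0 : ℝ) ≤ c + 1 by positivity)
    calc ((c : ℝ) + 1) * Real.log n ≤ (c + 1) * (Real.log 2 / (c + 1) * (n : ℝ) ^ ε) := this
      _ = Real.log 2 * (n : ℝ) ^ ε := by field_simp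
  calc ((n ^ c + c : ℕ) : ℝ) ≤ ((n ^ (c + 1) : ℕ) : ℝ) := by exact_mod_cast hnat
    _ = Real.exp (((c : ℝ) + 1) * Real.log n) := by
        rw [← Real.log_rpow hn0, Real.exp_log (Real.rpow_pos_of_pos hn0 _)]
        norm_cast
    _ ≤ Real.exp (Real.log 2 * (n : ℝ) ^ ε) := Real.exp_le_exp.2 hlog'
    _ = 2 ^ ((n : ℝ) ^ ε) := (Real.rpow_def_of_pos two_pos _).symm

/-- `Nat.log 2 n ≤ log n / log 2` as reals (for `n ≠ 0`). [folklore] -/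
theorem natLog_two_le_log_div (n : ℕ) (hn : n ≠ 0) :
    (Nat.log 2 n : ℝ) ≤ Real.log n / Real.log 2 := by
  rw [le_div_iff₀ (Real.log_pos one_lt_two), ← Real.log_pow]
  refine Real.log_le_log (by positivity) ?_
  exact_mod_cast Nat.pow_log_le_self 2 hn

/-- `(log₂ n)²` is eventually below `a · n^δ` and below `n`: for `δ, a > 0` there is `N` with
`(Nat.log 2 n)² ≤ a n^δ` and `(Nat.log 2 n)² ≤ n` for `n ≥ N` (from `log x = o(x^{δ/2})`).
[folklore] -/
theorem exists_natLog_sq_le {δ a : ℝ} (hδ : 0 < δ) (ha : 0 < a) :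
    ∃ N : ℕ, ∀ n, N ≤ n →
      ((Nat.log 2 n : ℕ) : ℝ) ^ 2 ≤ a * (n : ℝ) ^ δ ∧ (Nat.log 2 n) ^ 2 ≤ n := by
  -- thresholds for the two estimates, both from `log x = o(x^θ)`
  have key : ∀ {θ b : ℝ}, 0 < θ → 0 < b → ∃ X : ℝ, ∀ n : ℕ, X ≤ n → 2 ≤ n →
      ((Nat.log 2 n : ℕ) : ℝ) ^ 2 ≤ b * (n : ℝ) ^ (2 * θ) := by
    intro θ b hθ hb
    have hκ : 0 < Real.sqrt b * Real.log 2 := mul_pos (Real.sqrt_pos.2 hb) (Real.log_pos one_lt_two)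
    obtain ⟨X, hX⟩ := Filter.eventually_atTop.1 ((isLittleO_log_rpow_atTop hθ).def hκ)
    refine ⟨X, fun n hnX hn2 => ?_⟩
    have hn0 : (0 : ℝ) < n := by exact_mod_cast (zero_lt_two.trans_le hn2)
    have hlog := hX n hnX
    rw [Real.norm_eq_abs, Real.norm_eq_abs, abs_of_nonneg (Real.log_nonneg (by exact_mod_cast
      (le_trans (by norm_num) hn2))), abs_of_nonneg (Real.rpow_nonneg hn0.le θ)] at hlog
    have hL := natLog_two_le_log_div n (by omega)
    have hL0 : (0 : ℝ) ≤ (Nat.log 2 n : ℕ) := Nat.cast_nonneg _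
    have h2 : 0 < Real.log 2 := Real.log_pos one_lt_two
    have hL' : ((Nat.log 2 n : ℕ) : ℝ) ≤ Real.sqrt b * (n : ℝ) ^ θ := by
      calc ((Nat.log 2 n : ℕ) : ℝ) ≤ Real.log n / Real.log 2 := hL
        _ ≤ Real.sqrt b * Real.log 2 * (n : ℝ) ^ θ / Real.log 2 :=
            div_le_div_of_nonneg_right hlog h2.le
        _ = Real.sqrt b * (n : ℝ) ^ θ := by field_simp
    calc ((Nat.log 2 n : ℕ) : ℝ) ^ 2 ≤ (Real.sqrt b * (n : ℝ) ^ θ) ^ 2 :=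
          pow_le_pow_left₀ hL0 hL' 2
      _ = b * (n : ℝ) ^ (2 * θ) := by
          rw [mul_pow, Real.sq_sqrt hb.le, ← Real.rpow_natCast, ← Real.rpow_mul hn0.le]
          congr 1
          push_cast
          ring_nf
  obtain ⟨X₁, hX₁⟩ := key (half_pos hδ) ha
  obtain ⟨X₂, hX₂⟩ := key (θ := 1 / 2) (b := 1) (by norm_num) one_pos
  refine ⟨max (max ⌈X₁⌉₊ ⌈X₂⌉₊) 2, fun n hn => ?_⟩
  have hn2 : 2 ≤ n := (le_max_right _ _).trans hn
  have hn₁ : X₁ ≤ n := (Nat.le_ceil X₁).trans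
    (by exact_mod_cast (le_max_left _ _).trans ((le_max_left _ _).trans hn))
  have hn₂ : X₂ ≤ n := (Nat.le_ceil X₂).trans
    (by exact_mod_cast (le_max_right _ _).trans ((le_max_left _ _).trans hn))
  refine ⟨?_, ?_⟩
  · have := hX₁ n hn₁ hn2
    rwa [show 2 * (δ / 2) = δ by ring] at this
  · have := hX₂ n hn₂ hn2
    rw [show (2 : ℝ) * (1 / 2) = 1 by norm_num, Real.rpow_one, one_mul] at this
    exact_mod_cast this

/-- **Theorem 4.1 implies its polynomial-size form** (Williams 2014, proof of Thm. 1.1, p. 18: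
"the Circuit SAT algorithm of Theorem 4.1 can determine satisfiability of any `n + c log n`
input, `n ^ c` size ACC circuit in `O(2^{n − log² n})` time, for every constant `c`"): for `n`
large, `n ^ c + c ≤ 2^{n^ε}` and `⌊2^{n - a n^δ}⌋ ≤ 2^{n - (log₂ n)²} = 2ⁿ / 2^{(log₂ n)²}`;
the finitely many smaller `n` are absorbed by the additive constant
(`AccSatInTime.of_le_of_bdd`), and depths `d ≤ 1` are instances of depth `2`.
[cite: Williams2014, Thm. 4.1 and proof of Thm. 1.1] -/
theorem Williams2014_accSat_polysize_of_thm_4_1 (h : Williams2014_thm_4_1) :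
    Williams2014_accSat_polysize := by
  intro d m c hm
  obtain ⟨ε, δ, a, hε, -, hεδ, ha, H⟩ := h (max d 2) m (by omega) hm
  have hδ : 0 < δ := hε.trans hεδ
  obtain ⟨N, hN⟩ := exists_pow_add_le_two_rpow c hε
  have h1 : AccSatInTime d m (fun n => n ^ c + c)
      (fun n => ⌊(2 : ℝ) ^ ((n : ℝ) - a * (n : ℝ) ^ δ)⌋₊) :=
    (H (fun n => n ^ c + c) N hN).anti_depth (le_max_left d 2)
  obtain ⟨N', hN'⟩ := exists_natLog_sq_le hδ ha
  have hfloor : ∀ (x : ℝ) (k : ℕ), (2 : ℝ) ^ x ≤ ((2 ^ k : ℕ) : ℝ) → ⌊(2 : ℝ) ^ x⌋₊ ≤ 2 ^ k :=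
    fun x k hx => (Nat.floor_mono hx).trans (Nat.floor_natCast _).le
  refine h1.of_le_of_bdd N' (2 ^ N') (fun n hn => ?_) (fun n hn => ?_)
  · obtain ⟨hlog, hLn⟩ := hN' n hn
    rw [Nat.pow_div hLn two_pos]
    refine hfloor _ _ ?_
    rw [Nat.cast_pow, Nat.cast_two, ← Real.rpow_natCast]
    refine Real.rpow_le_rpow_of_exponent_le one_le_two ?_
    rw [Nat.cast_sub hLn, Nat.cast_pow]
    linarith
  · refine hfloor _ _ ?_
    rw [Nat.cast_pow, Nat.cast_two, ← Real.rpow_natCast]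
    refine Real.rpow_le_rpow_of_exponent_le one_le_two ?_
    have h0 : 0 ≤ a * (n : ℝ) ^ δ := mul_nonneg ha.le (Real.rpow_nonneg (Nat.cast_nonneg n) δ)
    have hnN : (n : ℝ) ≤ N' := by exact_mod_cast hn.le
    linarith

/-- The complete reduction recorded in one statement: Williams' transfer theorem for `ACC`
(Thm. 1.3, `Williams2014_lowerBound_of_accSat`) and Theorem 4.1 as printed imply
`williams_acc : NTIME(2ⁿ) ⊄ ACC⁰` (Williams 2014, proof of Thm. 1.1). [cite: Williams2014, Thm. 1.1 and its proof] -/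
theorem williams_acc_of_thm_1_3_of_thm_4_1 (h13 : Williams2014_lowerBound_of_accSat)
    (h41 : Williams2014_thm_4_1) : williams_acc :=
  williams_acc_of_Williams2014 h13 (Williams2014_accSat_polysize_of_thm_4_1 h41)

/-! ### The literal reading and the `ε = 1/r` reading (Murray–Williams 2018, Thm. 5.1) -/

/-- The literal instance of Theorem 4.1: the size bound `⌊2^{n^ε}⌋` itself, at every `n`
(take `s n = ⌊2^{n^ε}⌋`, threshold `0`). [cite: Williams2014, Thm. 4.1] -/
theorem Williams2014_thm_4_1.literal (h : Williams2014_thm_4_1) {d m : ℕ} (hd : 1 < d)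
    (hm : 2 ≤ m) :
    ∃ ε δ a : ℝ, 0 < ε ∧ ε < 1 ∧ ε < δ ∧ 0 < a ∧
      AccSatInTime d m (fun n => ⌊(2 : ℝ) ^ ((n : ℝ) ^ ε)⌋₊)
        (fun n => ⌊(2 : ℝ) ^ ((n : ℝ) - a * (n : ℝ) ^ δ)⌋₊) := by
  obtain ⟨ε, δ, a, hε, hε1, hεδ, ha, H⟩ := h d m hd hm
  exact ⟨ε, δ, a, hε, hε1, hεδ, ha, H _ 0 fun n _ => Nat.floor_le (by positivity)⟩

/-- **Theorem 4.1 gives the `ε = 1/r` form `MurrayWilliams2018_thm_5_1`** (Murray–Williams 2018,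
Thm. 5.1, which for circuits without threshold gates is Williams 2014, Thm. 4.1, as recorded in
`MurrayWilliams2018.lean`): with `r ≥ 2` an integer exceeding `1/ε`, the size bound
`2^{⌊n^{1/r}⌋}` is at most `2^{n^ε}` for `n ≥ 1` (`⌊n^{1/r}⌋ ≤ n^{1/r} ≤ n^ε`), and the time
`⌊2^{n - a n^δ}⌋` is at most `2^{n - ⌊n^{1/r}⌋}` for `n` large, because `δ > ε > 1/r` gives
`n^{1/r} ≤ a n^δ` eventually; smaller `n` and depths `d ≤ 1` as before.
[cite: Williams2014, Thm. 4.1] -/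
theorem MurrayWilliams2018_thm_5_1_of_thm_4_1 (h : Williams2014_thm_4_1) :
    MurrayWilliams2018_thm_5_1 := by
  intro d m hm
  obtain ⟨ε, δ, a, hε, -, hεδ, ha, H⟩ := h (max d 2) m (by omega) hm
  -- an integer `r ≥ 2` with `1/r < ε`
  obtain ⟨r, hr2, hrε⟩ : ∃ r : ℕ, 2 ≤ r ∧ 1 / (r : ℝ) < ε := by
    refine ⟨max 2 (⌈1 / ε⌉₊ + 1), le_max_left _ _, ?_⟩
    have hR : (0 : ℝ) < (max 2 (⌈1 / ε⌉₊ + 1) : ℕ) := by positivity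
    have h1 : (1 / ε : ℝ) < (max 2 (⌈1 / ε⌉₊ + 1) : ℕ) := by
      calc (1 / ε : ℝ) ≤ ⌈1 / ε⌉₊ := Nat.le_ceil _
        _ < ((⌈1 / ε⌉₊ + 1 : ℕ) : ℝ) := by exact_mod_cast Nat.lt_succ_self _
        _ ≤ (max 2 (⌈1 / ε⌉₊ + 1) : ℕ) := by exact_mod_cast le_max_right _ _
    rw [div_lt_iff₀ hε] at h1
    rw [div_lt_iff₀ hR, mul_comm]
    exact h1
  have hr0 : r ≠ 0 := by omega
  refine ⟨r, hr2, ?_⟩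
  rw [accSatSubexp_iff]
  -- size: `2 ^ ⌊n^{1/r}⌋ ≤ 2 ^ (n^ε)` for `n ≥ 1`
  have hsize : ∀ n, 1 ≤ n → ((2 ^ Nat.nthRoot r n : ℕ) : ℝ) ≤ 2 ^ ((n : ℝ) ^ ε) := by
    intro n hn
    rw [Nat.cast_pow, Nat.cast_two, ← Real.rpow_natCast]
    refine Real.rpow_le_rpow_of_exponent_le one_le_two ?_
    calc (Nat.nthRoot r n : ℝ) ≤ (n : ℝ) ^ ((r : ℝ)⁻¹) := nthRoot_le_rpow r n
      _ ≤ (n : ℝ) ^ ε :=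
          Real.rpow_le_rpow_of_exponent_le (by exact_mod_cast hn) (by rw [← one_div]; exact hrε.le)
  have h1 : AccSatInTime d m (fun n => 2 ^ Nat.nthRoot r n)
      (fun n => ⌊(2 : ℝ) ^ ((n : ℝ) - a * (n : ℝ) ^ δ)⌋₊) :=
    (H _ 1 hsize).anti_depth (le_max_left d 2)
  -- time: `n^{1/r} ≤ a n^δ` eventually, from `n^{δ - 1/r} → ∞`
  have hgap : 0 < δ - 1 / r := by linarith
  obtain ⟨X, hX⟩ := Filter.eventually_atTop.1
    ((tendsto_rpow_atTop hgap).eventually_ge_atTop (1 / a))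
  have hfloor : ∀ (x : ℝ) (k : ℕ), (2 : ℝ) ^ x ≤ ((2 ^ k : ℕ) : ℝ) → ⌊(2 : ℝ) ^ x⌋₊ ≤ 2 ^ k :=
    fun x k hx => (Nat.floor_mono hx).trans (Nat.floor_natCast _).le
  refine h1.of_le_of_bdd (max ⌈X⌉₊ 1) (2 ^ max ⌈X⌉₊ 1) (fun n hn => ?_) (fun n hn => ?_)
  · have hn1 : 1 ≤ n := (le_max_right _ _).trans hn
    have hn0 : (0 : ℝ) < n := by exact_mod_cast hn1
    have hnX : X ≤ n := (Nat.le_ceil X).trans (by exact_mod_cast (le_max_left _ _).trans hn)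
    have hroot_le : Nat.nthRoot r n ≤ n := by
      have hp := Nat.pow_nthRoot_le (n := r) (a := n) (Or.inl hr0)
      rcases Nat.eq_zero_or_pos (Nat.nthRoot r n) with h0 | hpos
      · omega
      · exact (Nat.le_self_pow hr0 _).trans hp
    refine hfloor _ _ ?_
    rw [Nat.cast_pow, Nat.cast_two, ← Real.rpow_natCast]
    refine Real.rpow_le_rpow_of_exponent_le one_le_two ?_
    rw [Nat.cast_sub hroot_le]
    have key : (Nat.nthRoot r n : ℝ) ≤ a * (n : ℝ) ^ δ := by
      have hXn := hX n hnX
      rw [div_le_iff₀ ha] at hXn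
      calc (Nat.nthRoot r n : ℝ) ≤ (n : ℝ) ^ ((r : ℝ)⁻¹) := nthRoot_le_rpow r n
        _ = (n : ℝ) ^ (1 / (r : ℝ)) * 1 := by rw [one_div, mul_one]
        _ ≤ (n : ℝ) ^ (1 / (r : ℝ)) * ((n : ℝ) ^ (δ - 1 / r) * a) :=
            mul_le_mul_of_nonneg_left hXn (Real.rpow_nonneg hn0.le _)
        _ = a * (n : ℝ) ^ δ := by
            rw [← mul_assoc, ← Real.rpow_add hn0, mul_comm]
            congr 2
            ring
    linarith
  · refine hfloor _ _ ?_
    rw [Nat.cast_pow, Nat.cast_two, ← Real.rpow_natCast]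
    refine Real.rpow_le_rpow_of_exponent_le one_le_two ?_
    have h0 : 0 ≤ a * (n : ℝ) ^ δ := mul_nonneg ha.le (Real.rpow_nonneg (Nat.cast_nonneg n) δ)
    have hnN : (n : ℝ) ≤ (max ⌈X⌉₊ 1 : ℕ) := by exact_mod_cast hn.le
    linarith

/-- Hence Theorem 4.1 as printed also yields the threshold-free Murray–Williams lower bound
`MurrayWilliams2018_NTIME_not_depth_ACC` once their Thm. 1.2 is supplied
(`MurrayWilliams2018_NTIME_not_depth_ACC_of_components`). [cite: Williams2014, Thm. 4.1] -/
theorem MurrayWilliams2018_NTIME_not_depth_ACC_of_thm_1_2_of_thm_4_1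
    (h12 : MurrayWilliams2018_thm_1_2_acc) (h41 : Williams2014_thm_4_1) :
    MurrayWilliams2018_NTIME_not_depth_ACC :=
  MurrayWilliams2018_NTIME_not_depth_ACC_of_components h12
    (MurrayWilliams2018_thm_5_1_of_thm_4_1 h41)

/-! ### String encoding of `SYM⁺` circuits -/

/-- The code of a `SYM⁺` circuit `S` on the inputs `Fin n` as a list of naturals: `n`, the number
of terms, then for each term its cardinality followed by its variables in increasing order, then
the value table of the symmetric gate on the counts `0, 1, …, #terms` (as `0/1`; larger counts do
not occur, `SymPlus.count_le_size`). A design choice of this file (cf. Williams 2014, §4.1: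
the `SYM⁺` circuit is "a collection of `s` AND gates over some variables" together with a
symmetric function assumed efficiently evaluable; here it is tabulated). [folklore] -/
def symPlusCodeList {n : ℕ} (S : SymPlus n) : List ℕ :=
  n :: S.size :: (S.terms.flatMap fun t => t.card :: (t.sort (· ≤ ·)).map Fin.val) ++
    (List.range (S.size + 1)).map fun v => if S.sym v then 1 else 0

/-- The string encoding of a `SYM⁺` circuit handed to / produced by the machines of Lemmas 4.1
and 4.2: `symPlusCodeList` in the library's binary list encoding `encodingListNatBool` (as
`encodeAccCircuit`, `Williams2014.lean`). Its length is `O((s · k + s) · log (n + s))` for `s`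
terms of fan-in `≤ k`. [folklore] -/
def encodeSymPlus {n : ℕ} (S : SymPlus n) : List Bool :=
  encodingListNatBool.encode (symPlusCodeList S)

/-- The code starts with the number of inputs and the number of terms. [folklore] -/
theorem symPlusCodeList_take_two {n : ℕ} (S : SymPlus n) :
    (symPlusCodeList S).take 2 = [n, S.size] := rfl

/-! ### Lemma 4.1 (algorithmic conversion) and Lemma 4.2 (evaluation) as named facts -/

/-- **Algorithmic `ACC ⊆ SYM⁺` conversion** (Williams 2014, Lemma 4.1 with Appendix A, after
Yao 1990, Beigel–Tarui 1994, Allender–Gore 1994: "There is an algorithm and function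
`f : ℕ → ℕ` such that given an ACC circuit of depth `d` and size `s`, the algorithm outputs an
equivalent `SYM⁺` circuit of `s^{O(log^{f(d)} s)}` size. The algorithm takes at most
`s^{O(log^{f(d)} s)}` time. Furthermore, given the number of ANDs in the circuit that evaluate
to `1`, the symmetric function itself can be evaluated in `s^{O(log^{f(d)} s)}` time.").
Statement, per depth `d` and modulus `m ≥ 2`, with one exponent `e` absorbing the constants
(`s^{O(log^f s)} ≤ 2^{(log₂ s + 2)^e}`): there is a TM2 machine `M` which, started on the
encoding `encodeAccCircuit m C` of any circuit `C` over `accBasis m` of `acDepth ≤ d` on `n ≤ s`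
inputs with at most `s` gates of fan-in `≤ s`, halts within `2^{(log₂ s + 2)^e}` steps with
output `encodeSymPlus S` for some `SYM⁺` circuit `S` equivalent to `C` with at most
`2^{(log₂ s + 2)^e}` terms of fan-in `≤ (log₂ s + 2)^e` (the value table of the symmetric gate
is part of the output, which renders the "furthermore" clause). The existence of such an `S` is
the tree's theorem `Williams2014_symPlus_of_acc_holds`; the content here is the running time.
[cite: Williams2014, Lemma 4.1 and Appendix A] -/
def Williams2014_lemma_4_1 : Prop :=
  ∀ d m : ℕ, 2 ≤ m → ∃ (e : ℕ) (M : TM2ComputableAux Bool Bool),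
    ∀ (n s : ℕ) (C : Circuit (Fin n)), C.IsOver (accBasis m) → C.acDepth ≤ d → n ≤ s →
      C.size ≤ s → C.maxFanIn ≤ s →
        ∃ S : SymPlus n, S.size ≤ 2 ^ (Nat.log 2 s + 2) ^ e ∧
          S.maxFanIn ≤ (Nat.log 2 s + 2) ^ e ∧ (∀ x, S.eval x = C.eval x) ∧
          M.OutputsWithin (encodeAccCircuit m C) (encodeSymPlus S) (2 ^ (Nat.log 2 s + 2) ^ e)

/-- **The evaluation lemma** (Williams 2014, Lemma 4.2: "There is an algorithm that, given a
`SYM⁺` circuit of size `s ≤ 2^{0.1 n}` and `n` inputs with a symmetric function that can be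
evaluated in `poly(s)` time, runs in `(2ⁿ + poly(s)) · poly(n)` time and prints a `2ⁿ`-bit
vector `V` which is the truth table of the function represented by the given circuit. That is,
`V[i] = 1` iff the `SYM⁺` circuit outputs `1` on the `i`th variable assignment."; Proof 2 via
Yates' zeta transform, multitape implementation in Appendix C). Statement: there are a constant
`c` and a TM2 machine `E` such that for every `n` and every `SYM⁺` circuit `S` on `Fin n` with
`s = #terms`, `s ^ 10 ≤ 2 ^ n`, `E` started on `encodeSymPlus S` (which tabulates the symmetric
gate) halts within `c · (2ⁿ + sᶜ) · (n + 1)ᶜ + c` steps with output the truth table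
`MetaComplexity.truthTable S.eval` (`2ⁿ` bits, point `i` = binary digits of `i`, least
significant first). [cite: Williams2014, Lemma 4.2] -/
def Williams2014_lemma_4_2 : Prop :=
  ∃ (c : ℕ) (E : TM2ComputableAux Bool Bool), ∀ (n : ℕ) (S : SymPlus n), S.size ^ 10 ≤ 2 ^ n →
    E.OutputsWithin (encodeSymPlus S) (MetaComplexity.truthTable S.eval)
      (c * (2 ^ n + S.size ^ c) * (n + 1) ^ c + c)

end Literature.Computability.Complexity
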